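import Literature.NumberTheory.Transcendental.PadicLogPrincipalUnits
import HarnessLib

/-!
# The `ℓ`-adic logarithm on the OPEN ball `‖1 − y‖ < ℓ⁻¹` for EVERY prime `ℓ` (including `ℓ = 2`)

Topic `Literature/NumberTheory/Transcendental`; namespace
`Literature.NumberTheory.Transcendental.PadicExp`. Everything here is **proved**; no definition,
no named fact. Companion of `PadicLogPrincipalUnits.lean` (odd `ℓ`, CLOSED ball `‖1 − y‖ ≤ ℓ⁻¹`)
and `PadicExpBallProofs.lean` (any `ℓ`, exponential on the OPEN ball `‖a‖ < ℓ⁻¹`): for ANY prime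
`ℓ`, the logarithmic series `plog` and Mathlib's exponential are mutually inverse ISOMETRIES between
the principal units `‖1 − y‖ < ℓ⁻¹` and the open ball `‖a‖ < ℓ⁻¹` (Koblitz GTM 58 Ch. IV §1–2:
`exp_p` and `log_p` are inverse isometries on `ord_p > 1/(p−1)`; the ball `‖·‖ < ℓ⁻¹` lies inside,
and for `ℓ = 2` it IS that disc, `‖a‖ < ½`, i.e. `a ≡ 0 (mod 4)` in `ℚ₂`).  This is the `ℓ = 2`
normalisation needed by the `2`-adic theory of linear forms in logarithms of principal units
`α ≡ 1 (mod 4)` (crux `YuNinetyTwo` of route `PadicPrimesYuNinety`, cell abc-stewartyu), where the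
odd-prime files do not apply (`2/ℓ = 1`).

* `norm_plog_add_one_sub_le_of_norm_lt` — the dominant term: `‖plog y + (1 − y)‖ ≤ (ℓ‖1−y‖)·‖1−y‖`
  (`< ‖1 − y‖` when `0 < ‖1 − y‖ < ℓ⁻¹`; each term `(1−y)ⁿ⁺²/(n+2)` has norm `≤ (n+2)ℓ^{-n}‖1−y‖²`);
* `norm_plog_of_norm_lt` — `‖plog y‖ = ‖1 − y‖`;
* `plog_exp_of_norm_lt` — `plog (exp a) = a` for `‖a‖ < ℓ⁻¹`; `exp_plog_of_norm_lt` —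
  `exp (plog y) = y`; `plog_injOn_ball`; `exp_natCast_mul_plog_of_norm_lt`,
  `exp_intCast_mul_plog_of_norm_lt` — `exp (s · plog y) = yˢ`;
* `exp_mul_plog_pow_eq` — **roots**: for `‖c‖ ≤ 1` and `n · c = 1` in `E`,
  `(exp (c · plog y))ⁿ = y` and `‖exp (c · plog y) − 1‖ = ‖c‖ · ‖1 − y‖` — e.g. the principal CUBE
  root at `ℓ = 2` (`c = 3⁻¹`, `‖3⁻¹‖₂ = 1`) used by the `q = 3` descent, or the square root at odd `ℓ`.

## References
* N. Koblitz, *p-adic Numbers, p-adic Analysis, and Zeta-Functions*, GTM 58 (1984), Ch. IV §1–2.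
* Kunrui Yu, *Linear forms in p-adic logarithms II*, Compositio Math. 74 (1990), §1.1.
-/

noncomputable section

open NormedSpace Filter Topology Metric IsUltrametricDist Finset
open scoped Nat

namespace Literature.NumberTheory.Transcendental

namespace PadicExp

variable {ℓ : ℕ} [Fact ℓ.Prime]
variable {E : Type*} [NontriviallyNormedField E] [NormedAlgebra ℚ_[ℓ] E]

section Complete

variable [CompleteSpace E] [IsUltrametricDist E]

/-! ### `plog` is an isometry on the open ball `‖1 − y‖ < ℓ⁻¹` -/

/-- **The dominant term, strict form, any prime `ℓ`**: for `0 < ‖1 − y‖ < ℓ⁻¹`,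
`‖plog y + (1 − y)‖ < ‖1 − y‖` (each term `(1−y)ⁿ⁺²/(n+2)` has norm
`≤ (n+2)‖1−y‖ⁿ⁺² ≤ (ℓ‖1−y‖)·‖1−y‖ < ‖1−y‖`, since `(n+2) ℓ^{-(n+1)} ≤ 1`).
[cite: Koblitz1984, Ch. IV §1] -/
theorem norm_plog_add_one_sub_le_of_norm_lt {y : E} (hy : ‖1 - y‖ < (ℓ : ℝ)⁻¹) :
    ‖plog y + (1 - y)‖ ≤ (ℓ * ‖1 - y‖) * ‖1 - y‖ := by
  have hp : ℓ.Prime := Fact.out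
  have hℓ1 : (1 : ℝ) < ℓ := by exact_mod_cast hp.one_lt
  have hℓ0 : (0 : ℝ) < ℓ := by linarith
  have ht1 : ‖1 - y‖ < 1 := hy.trans (inv_lt_one_of_one_lt₀ hℓ1)
  have hs := hasSum_plog (ℓ := ℓ) ht1
  have hs1 : HasSum (fun n : ℕ => -((1 - y) ^ (n + 2)) / (n + 2 : E)) (plog y + (1 - y)) := by
    have h := (hasSum_nat_add_iff' 1).mpr hs
    simp only [Finset.sum_range_one, zero_add, pow_one, Nat.cast_zero, div_one] at h
    have e2 : plog y + (1 - y) = plog y - -(1 - y) := by ring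
    have ef : (fun n : ℕ => -((1 - y) ^ (n + 2)) / (n + 2 : E)) =
        (fun n : ℕ => -(1 - y) ^ (n + 1 + 1) / ((n + 1 : ℕ) + 1 : E)) := by
      funext n; push_cast; ring_nf
    rw [e2, ef]; exact h
  rw [← hs1.tsum_eq]
  refine norm_tsum_le_of_forall_le_of_nonneg (by positivity) fun n => ?_
  have hterm := IwasawaLog.norm_logTerm_le (p := ℓ) (F := E) (1 - y) (n + 1)
  have e1 : -((1 - y) ^ (n + 1 + 1)) / ((n + 1 : ℕ) + 1 : E) = -((1 - y) ^ (n + 2)) / (n + 2 : E) := by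
    push_cast; ring_nf
  rw [e1] at hterm
  refine hterm.trans ?_
  -- `(n+2) t^{n+2} ≤ (n+2) ℓ^{-n} t · t · (ℓ t)/ℓ … ≤ (ℓ t) t`
  set t : ℝ := ‖1 - y‖ with ht
  have ht0 : 0 ≤ t := norm_nonneg _
  have htl : t ≤ (ℓ : ℝ)⁻¹ := hy.le
  -- `t^{n+2} = t · t · t^n ≤ t · t · ℓ^{-n}`
  have hpow : t ^ (n + 1 + 1) ≤ t * t * ((ℓ : ℝ)⁻¹) ^ n := by
    rw [pow_succ, pow_succ]
    have h1 : t ^ n ≤ ((ℓ : ℝ)⁻¹) ^ n := pow_le_pow_left₀ ht0 htl n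
    calc t ^ n * t * t = t * t * t ^ n := by ring
      _ ≤ t * t * ((ℓ : ℝ)⁻¹) ^ n := mul_le_mul_of_nonneg_left h1 (mul_nonneg ht0 ht0)
  -- `(n+2) ℓ^{-n} ≤ ℓ`
  have hcoef : ((n + 1 + 1 : ℕ) : ℝ) * ((ℓ : ℝ)⁻¹) ^ n ≤ ℓ := by
    have hnat : n + 2 ≤ ℓ * ℓ ^ n := by
      have h1 : n + 1 < 2 ^ (n + 1) := (n + 1).lt_two_pow_self
      have h2 : 2 ^ n ≤ ℓ ^ n := Nat.pow_le_pow_left hp.two_le n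
      have h3 : 2 * ℓ ^ n ≤ ℓ * ℓ ^ n := Nat.mul_le_mul_right _ hp.two_le
      rw [pow_succ] at h1
      omega
    have hR : ((n + 1 + 1 : ℕ) : ℝ) ≤ (ℓ : ℝ) * (ℓ : ℝ) ^ n := by exact_mod_cast hnat
    rw [inv_pow]
    have hℓn : (0 : ℝ) < (ℓ : ℝ) ^ n := by positivity
    calc ((n + 1 + 1 : ℕ) : ℝ) * ((ℓ : ℝ) ^ n)⁻¹ ≤ ((ℓ : ℝ) * (ℓ : ℝ) ^ n) * ((ℓ : ℝ) ^ n)⁻¹ :=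
          mul_le_mul_of_nonneg_right hR (by positivity)
      _ = ℓ := by field_simp
  calc ((n + 1 + 1 : ℕ) : ℝ) * t ^ (n + 1 + 1)
      ≤ ((n + 1 + 1 : ℕ) : ℝ) * (t * t * ((ℓ : ℝ)⁻¹) ^ n) :=
        mul_le_mul_of_nonneg_left hpow (by positivity)
    _ = (((n + 1 + 1 : ℕ) : ℝ) * ((ℓ : ℝ)⁻¹) ^ n) * (t * t) := by ring
    _ ≤ (ℓ : ℝ) * (t * t) := mul_le_mul_of_nonneg_right hcoef (mul_nonneg ht0 ht0)
    _ = (ℓ * t) * t := by ring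

/-- **`‖plog y‖ = ‖1 − y‖`** on the open ball `‖1 − y‖ < ℓ⁻¹`, ANY prime `ℓ` (for `ℓ = 2`:
`y ≡ 1 (mod 4)`). [cite: Koblitz1984, Ch. IV §1] -/
theorem norm_plog_of_norm_lt {y : E} (hy : ‖1 - y‖ < (ℓ : ℝ)⁻¹) : ‖plog y‖ = ‖1 - y‖ := by
  have hp : ℓ.Prime := Fact.out
  have hℓ0 : (0 : ℝ) < ℓ := by exact_mod_cast hp.pos
  by_cases ht0 : 1 - y = 0
  · have : y = 1 := by rw [sub_eq_zero] at ht0; exact ht0.symm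
    rw [this, plog_one, sub_self]
  have hpos : 0 < ‖1 - y‖ := norm_pos_iff.mpr ht0
  have hlt1 : (ℓ : ℝ) * ‖1 - y‖ < 1 := by
    calc (ℓ : ℝ) * ‖1 - y‖ < ℓ * (ℓ : ℝ)⁻¹ := mul_lt_mul_of_pos_left hy hℓ0
      _ = 1 := mul_inv_cancel₀ hℓ0.ne'
  have hlt : ‖plog y + (1 - y)‖ < ‖1 - y‖ := by
    refine (norm_plog_add_one_sub_le_of_norm_lt (ℓ := ℓ) hy).trans_lt ?_
    calc (ℓ * ‖1 - y‖) * ‖1 - y‖ < 1 * ‖1 - y‖ := mul_lt_mul_of_pos_right hlt1 hpos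
      _ = ‖1 - y‖ := one_mul _
  have e : plog y = (plog y + (1 - y)) + (-(1 - y)) := by ring
  rw [e]
  have hne : ‖plog y + (1 - y)‖ ≠ ‖-(1 - y)‖ := by rw [norm_neg]; exact hlt.ne
  rw [norm_add_eq_max_of_norm_ne_norm hne, norm_neg, max_eq_right hlt.le]

/-! ### `plog` inverts `exp` on the open ball, any prime -/

/-- **`plog (exp a) = a`** for `‖a‖ < ℓ⁻¹`, ANY prime `ℓ`: both sides are the limit of
`((exp a)^{ℓ^k} − 1)/ℓ^k = (exp (ℓ^k a) − 1)/ℓ^k` (`IwasawaLog.tendsto_pow_prime_pow_sub_one_div`,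
`‖exp b − 1 − b‖ ≤ ℓ‖b‖²`). [cite: Koblitz1984, Ch. IV §1] -/
theorem plog_exp_of_norm_lt {a : E} (ha : ‖a‖ < (ℓ : ℝ)⁻¹) : plog (exp a) = a := by
  have hp : ℓ.Prime := Fact.out
  have hℓ0 : (0 : ℝ) < ℓ := by exact_mod_cast hp.pos
  have hℓinv1 : (ℓ : ℝ)⁻¹ < 1 := inv_lt_one_of_one_lt₀ (by exact_mod_cast hp.one_lt)
  have hy : ‖1 - exp a‖ < 1 := by
    rw [norm_sub_rev, norm_exp_sub_one (ℓ := ℓ) ha]; exact ha.trans hℓinv1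
  have hlim := IwasawaLog.tendsto_pow_prime_pow_sub_one_div (p := ℓ) (exp a) hy
  change Tendsto _ atTop (𝓝 (plog (exp a))) at hlim
  have hP0 : ∀ k : ℕ, ((ℓ : E) ^ k) ≠ 0 := fun k =>
    pow_ne_zero k (norm_pos_iff.mp (by rw [norm_natCast_prime (ℓ := ℓ)]; positivity))
  have hnormP : ∀ k : ℕ, ‖(ℓ : E) ^ k‖ = ((ℓ : ℝ)⁻¹) ^ k := fun k => by
    rw [norm_pow, norm_natCast_prime (ℓ := ℓ)]
  -- every `ℓ^k a` is in the open ball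
  have hak : ∀ k : ℕ, ‖(ℓ : E) ^ k * a‖ < (ℓ : ℝ)⁻¹ := fun k => by
    rw [norm_mul, hnormP]
    exact (mul_le_of_le_one_left (norm_nonneg _) (pow_le_one₀ (by positivity) hℓinv1.le)).trans_lt ha
  have heq : ∀ k : ℕ, ((exp a) ^ (ℓ ^ k) - 1) / (ℓ : E) ^ k - a =
      (exp ((ℓ : E) ^ k * a) - 1 - (ℓ : E) ^ k * a) / (ℓ : E) ^ k := by
    intro k
    have e1 : (exp a) ^ (ℓ ^ k) = exp ((ℓ : E) ^ k * a) := by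
      rw [← exp_natCast_mul (ℓ := ℓ) ha (ℓ ^ k)]; push_cast; rfl
    rw [e1]; field_simp [hP0 k]
  have hlim' : Tendsto (fun k : ℕ => ((exp a) ^ (ℓ ^ k) - 1) / (ℓ : E) ^ k) atTop (𝓝 a) := by
    have hzero : Tendsto (fun k : ℕ => ((exp a) ^ (ℓ ^ k) - 1) / (ℓ : E) ^ k - a) atTop (𝓝 0) := by
      have hgeom : Tendsto (fun k : ℕ => ((ℓ : ℝ)⁻¹) ^ k * (‖a‖ * (‖a‖ * ℓ))) atTop (𝓝 0) := by
        have := (tendsto_pow_atTop_nhds_zero_of_lt_one (by positivity) hℓinv1).mul_const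
          (‖a‖ * (‖a‖ * ℓ))
        simpa using this
      refine squeeze_zero_norm' ?_ hgeom
      filter_upwards [Filter.eventually_ge_atTop 0] with k _
      rw [heq k, norm_div, hnormP k]
      have h1 := norm_exp_sub_one_sub_self_le (ℓ := ℓ) (hak k)
      have hPk : 0 < ((ℓ : ℝ)⁻¹) ^ k := by positivity
      rw [div_le_iff₀ hPk]
      refine h1.trans (le_of_eq ?_)
      rw [norm_mul, hnormP k]; ring
    simpa using hzero.add_const a
  exact tendsto_nhds_unique hlim hlim'

/-- **`exp (plog y) = y`** for `‖1 − y‖ < ℓ⁻¹`, ANY prime `ℓ` (so `exp` maps the open ball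
`‖a‖ < ℓ⁻¹` ONTO the principal units `‖1 − y‖ < ℓ⁻¹`; for `ℓ = 2`: `4ℤ₂ → 1 + 4ℤ₂`).
[cite: Koblitz1984, Ch. IV §2] -/
theorem exp_plog_of_norm_lt {y : E} (hy : ‖1 - y‖ < (ℓ : ℝ)⁻¹) : exp (plog y) = y := by
  have hp : ℓ.Prime := Fact.out
  have hℓinv1 : (ℓ : ℝ)⁻¹ < 1 := inv_lt_one_of_one_lt₀ (by exact_mod_cast hp.one_lt)
  have hy1 : ‖1 - y‖ < 1 := hy.trans hℓinv1
  have hny : ‖y‖ = 1 := IwasawaLog.norm_eq_one_of_norm_one_sub_lt hy1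
  have hy0 : y ≠ 0 := norm_pos_iff.mp (by rw [hny]; exact one_pos)
  have hL : ‖plog y‖ < (ℓ : ℝ)⁻¹ := by rw [norm_plog_of_norm_lt hy]; exact hy
  set y' : E := exp (plog y) with hy'
  have hy'1 : ‖1 - y'‖ < (ℓ : ℝ)⁻¹ := by
    rw [norm_sub_rev, hy', norm_exp_sub_one (ℓ := ℓ) hL, norm_plog_of_norm_lt hy]; exact hy
  have hlog : plog y' = plog y := plog_exp_of_norm_lt hL
  have hq1 : ‖1 - y' * y⁻¹‖ < (ℓ : ℝ)⁻¹ := by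
    have e : 1 - y' * y⁻¹ = y⁻¹ * ((1 - y') + -(1 - y)) := by field_simp; ring
    rw [e, norm_mul, norm_inv, hny, inv_one, one_mul]
    refine (norm_add_le_max _ _).trans_lt (max_lt hy'1 ?_)
    rw [norm_neg]; exact hy
  have hzero : plog (y' * y⁻¹) = 0 := by
    rw [plog_mul (ℓ := ℓ) (hy'1.trans hℓinv1) (IwasawaLog.norm_one_sub_inv_lt hy1),
      plog_inv (ℓ := ℓ) hy1, hlog, add_neg_cancel]
  have : ‖1 - y' * y⁻¹‖ = 0 := by rw [← norm_plog_of_norm_lt hq1, hzero, norm_zero]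
  have h1 : y' * y⁻¹ = 1 := by
    have := norm_eq_zero.mp this
    rw [sub_eq_zero] at this; exact this.symm
  calc y' = y' * y⁻¹ * y := by field_simp
    _ = y := by rw [h1, one_mul]

/-- **`plog` is injective on the principal units** `‖1 − y‖ < ℓ⁻¹`, any prime `ℓ`.
[cite: Koblitz1984, Ch. IV §2] -/
theorem plog_injOn_ball : Set.InjOn (plog : E → E) {y : E | ‖1 - y‖ < (ℓ : ℝ)⁻¹} := by
  intro y₁ h₁ y₂ h₂ h
  rw [← exp_plog_of_norm_lt (ℓ := ℓ) (y := y₁) h₁, ← exp_plog_of_norm_lt (ℓ := ℓ) (y := y₂) h₂]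
  exact congrArg exp h

/-- **Interpolation of powers**: `exp (s · plog y) = yˢ` (`s ∈ ℕ`), any prime.
[cite: Koblitz1984, Ch. IV §2] -/
theorem exp_natCast_mul_plog_of_norm_lt {y : E} (hy : ‖1 - y‖ < (ℓ : ℝ)⁻¹) (s : ℕ) :
    exp ((s : E) * plog y) = y ^ s := by
  have hL : ‖plog y‖ < (ℓ : ℝ)⁻¹ := by rw [norm_plog_of_norm_lt hy]; exact hy
  rw [exp_natCast_mul (ℓ := ℓ) hL, exp_plog_of_norm_lt hy]

/-- `exp (z · plog y) = yᶻ` (`z ∈ ℤ`), any prime. [cite: Koblitz1984, Ch. IV §2] -/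
theorem exp_intCast_mul_plog_of_norm_lt {y : E} (hy : ‖1 - y‖ < (ℓ : ℝ)⁻¹) (z : ℤ) :
    exp ((z : E) * plog y) = y ^ z := by
  have hL : ‖plog y‖ < (ℓ : ℝ)⁻¹ := by rw [norm_plog_of_norm_lt hy]; exact hy
  rw [exp_intCast_mul (ℓ := ℓ) hL, exp_plog_of_norm_lt hy]

/-! ### Roots of principal units by interpolation: `exp (c · plog y)` with `n · c = 1` -/

/-- For `‖c‖ ≤ 1`, `c · plog y` is in the open ball. [cite: Koblitz1984, Ch. IV §2] -/
theorem norm_mul_plog_lt {y : E} (hy : ‖1 - y‖ < (ℓ : ℝ)⁻¹) {c : E} (hc : ‖c‖ ≤ 1) :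
    ‖c * plog y‖ < (ℓ : ℝ)⁻¹ := by
  rw [norm_mul, norm_plog_of_norm_lt hy]
  exact (mul_le_of_le_one_left (norm_nonneg _) hc).trans_lt hy

/-- **Principal `n`-th roots by interpolation** (any prime `ℓ`): if `‖c‖ ≤ 1` and `n · c = 1` in
`E`, then `(exp (c · plog y))ⁿ = y` for every principal unit `‖1 − y‖ < ℓ⁻¹` — e.g. the principal
CUBE root at `ℓ = 2` (`c = 3⁻¹`) of the `q = 3` descent, the square root at odd `ℓ` (`c = 2⁻¹`).
[cite: Koblitz1984, Ch. IV §2] -/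
theorem exp_mul_plog_pow_eq {y : E} (hy : ‖1 - y‖ < (ℓ : ℝ)⁻¹) {c : E} (hc : ‖c‖ ≤ 1) {n : ℕ}
    (hn : (n : E) * c = 1) : (exp (c * plog y)) ^ n = y := by
  rw [← exp_natCast_mul (ℓ := ℓ) (norm_mul_plog_lt hy hc) n, ← mul_assoc, hn, one_mul,
    exp_plog_of_norm_lt hy]

/-- The root is again a principal unit: `‖exp (c · plog y) − 1‖ = ‖c‖ · ‖1 − y‖`.
[cite: Koblitz1984, Ch. IV §2] -/
theorem norm_exp_mul_plog_sub_one {y : E} (hy : ‖1 - y‖ < (ℓ : ℝ)⁻¹) {c : E} (hc : ‖c‖ ≤ 1) :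
    ‖exp (c * plog y) - 1‖ = ‖c‖ * ‖1 - y‖ := by
  rw [norm_exp_sub_one (ℓ := ℓ) (norm_mul_plog_lt hy hc), norm_mul, norm_plog_of_norm_lt hy]

/-- **Interpolation at the fractional points**: `exp (s · (c · plog y)) = (exp (c · plog y))ˢ`
(`s ∈ ℕ`; the values of the auxiliary functions of the `q`-descent at the points `s/q`).
[cite: Koblitz1984, Ch. IV §2] -/
theorem exp_natCast_mul_mul_plog {y : E} (hy : ‖1 - y‖ < (ℓ : ℝ)⁻¹) {c : E} (hc : ‖c‖ ≤ 1)
    (s : ℕ) : exp ((s : E) * (c * plog y)) = (exp (c * plog y)) ^ s :=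
  exp_natCast_mul (ℓ := ℓ) (norm_mul_plog_lt hy hc) s

omit [CompleteSpace E] [IsUltrametricDist E] in
/-- **The `2`-adic case of the cube root**: `‖3⁻¹‖ = 1` in a normed `ℚ₂`-algebra field, so
`exp_mul_plog_pow_eq` applies with `c = 3⁻¹`, `n = 3` at `ℓ = 2`. More generally `‖(m : E)⁻¹‖ = 1`
for `m` coprime to `ℓ`. [cite: Koblitz1984, Ch. I §2] -/
theorem norm_inv_natCast_eq_one_of_coprime {m : ℕ} (hm : m.Coprime ℓ) : ‖((m : E))⁻¹‖ = 1 := by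
  have hp : ℓ.Prime := Fact.out
  have h1 : ‖(m : E)‖ = 1 := by
    rw [norm_natCast (ℓ := ℓ), Padic.norm_natCast_eq_one_iff]
    exact hm.symm
  rw [norm_inv, h1, inv_one]

/-! ### Finite sums: `exp` of a sum in the open ball, values of products of powers -/

omit [NormedAlgebra ℚ_[ℓ] E] [CompleteSpace E] in
/-- A finite sum of elements of the open ball `‖·‖ < ℓ⁻¹` is in the open ball (ultrametric).
[cite: Koblitz1984, Ch. IV §1] -/
theorem norm_sum_lt_of_forall_lt {ι : Type*} (t : Finset ι) (a : ι → E)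
    (ha : ∀ i ∈ t, ‖a i‖ < (ℓ : ℝ)⁻¹) : ‖∑ i ∈ t, a i‖ < (ℓ : ℝ)⁻¹ := by
  classical
  have hp : ℓ.Prime := Fact.out
  have hℓ0 : (0 : ℝ) < (ℓ : ℝ)⁻¹ := by
    have : (0 : ℝ) < ℓ := by exact_mod_cast hp.pos
    positivity
  induction t using Finset.induction_on with
  | empty => simpa using hℓ0
  | insert j t hj ih =>
    rw [sum_insert hj]
    refine (norm_add_le_max _ _).trans_lt (max_lt (ha j (mem_insert_self j t)) ?_)
    exact ih fun i hi => ha i (mem_insert_of_mem hi)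

/-- **`exp` of a finite sum of multiples of logarithms is the product**, any prime:
`exp (∑ cᵢ · plog yᵢ) = ∏ exp (cᵢ · plog yᵢ)` for principal units `‖1 − yᵢ‖ < ℓ⁻¹` and `‖cᵢ‖ ≤ 1`
(the general `exp (∑ aᵢ) = ∏ exp aᵢ` on the open ball is the tree's
`Literature.NumberTheory.GaloisRepresentations.Expansion.exp_sum`; this is the form the
interpolation values need, proved directly to keep the imports light).
[cite: Koblitz1984, Ch. IV §1] -/
theorem exp_sum_mul_plog {ι : Type*} (t : Finset ι) (y : ι → E) (c : ι → E)
    (hy : ∀ i ∈ t, ‖1 - y i‖ < (ℓ : ℝ)⁻¹) (hc : ∀ i ∈ t, ‖c i‖ ≤ 1) :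
    exp (∑ i ∈ t, c i * plog (y i)) = ∏ i ∈ t, exp (c i * plog (y i)) := by
  classical
  have hterm : ∀ i ∈ t, ‖c i * plog (y i)‖ < (ℓ : ℝ)⁻¹ := fun i hi =>
    norm_mul_plog_lt (ℓ := ℓ) (hy i hi) (hc i hi)
  induction t using Finset.induction_on with
  | empty => simp
  | insert j t hj ih =>
    have hrest : ‖∑ i ∈ t, c i * plog (y i)‖ < (ℓ : ℝ)⁻¹ :=
      norm_sum_lt_of_forall_lt (ℓ := ℓ) t _ fun i hi => hterm i (mem_insert_of_mem hi)
    rw [sum_insert hj, prod_insert hj, exp_add (ℓ := ℓ) (hterm j (mem_insert_self j t)) hrest,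
      ih (fun i hi => hy i (mem_insert_of_mem hi)) (fun i hi => hc i (mem_insert_of_mem hi))
        (fun i hi => hterm i (mem_insert_of_mem hi))]

/-- **Values at the integers**: `exp (∑ zᵢ · plog yᵢ) = ∏ yᵢ^{zᵢ}` (`zᵢ ∈ ℤ`) for principal units
`‖1 − yᵢ‖ < ℓ⁻¹`, any prime — the values of the auxiliary function `z ↦ exp (z · ∑ bᵢ plog αᵢ)` at
the integer nodes. [cite: Koblitz1984, Ch. IV §2] -/
theorem exp_sum_intCast_mul_plog {ι : Type*} (t : Finset ι) (y : ι → E) (z : ι → ℤ)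
    (hy : ∀ i ∈ t, ‖1 - y i‖ < (ℓ : ℝ)⁻¹) :
    exp (∑ i ∈ t, (z i : E) * plog (y i)) = ∏ i ∈ t, y i ^ z i := by
  rw [exp_sum_mul_plog (ℓ := ℓ) t y (fun i => (z i : E)) hy fun i _ => norm_intCast_le_one (ℓ := ℓ) (z i)]
  exact Finset.prod_congr rfl fun i hi => exp_intCast_mul_plog_of_norm_lt (ℓ := ℓ) (hy i hi) (z i)

/-- **Values at the fractional points `s/q`**: with `c = q⁻¹` (`‖c‖ ≤ 1`),
`exp (∑ nᵢ · (c · plog yᵢ)) = ∏ (exp (c · plog yᵢ))^{nᵢ}` (`nᵢ ∈ ℕ`) — the value at `s/q` is a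
monomial in the principal `q`-th roots `exp (c · plog yᵢ)` (cube roots at `ℓ = 2`, `q = 3`).
[cite: Koblitz1984, Ch. IV §2] -/
theorem exp_sum_natCast_mul_mul_plog {ι : Type*} (t : Finset ι) (y : ι → E) (n : ι → ℕ)
    (hy : ∀ i ∈ t, ‖1 - y i‖ < (ℓ : ℝ)⁻¹) {c : E} (hc : ‖c‖ ≤ 1) :
    exp (∑ i ∈ t, (n i : E) * (c * plog (y i))) = ∏ i ∈ t, (exp (c * plog (y i))) ^ n i := by
  have hnc : ∀ i ∈ t, ‖(n i : E) * c‖ ≤ 1 := fun i _ => by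
    rw [norm_mul]
    exact mul_le_one₀ (norm_natCast_le_one (ℓ := ℓ) (n i)) (norm_nonneg _) hc
  have e : ∑ i ∈ t, (n i : E) * (c * plog (y i)) = ∑ i ∈ t, ((n i : E) * c) * plog (y i) :=
    Finset.sum_congr rfl fun i _ => by rw [mul_assoc]
  rw [e, exp_sum_mul_plog (ℓ := ℓ) t y _ hy hnc]
  exact Finset.prod_congr rfl fun i hi => by
    rw [mul_assoc]; exact exp_natCast_mul_mul_plog (ℓ := ℓ) (hy i hi) hc (n i)

/-- Principal units of the open ball are closed under products of integer powers:
`‖1 − ∏ yᵢ^{zᵢ}‖ < ℓ⁻¹`. [cite: Koblitz1984, Ch. IV §1] -/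
theorem norm_one_sub_prod_zpow_lt {ι : Type*} (t : Finset ι) (y : ι → E) (z : ι → ℤ)
    (hy : ∀ i ∈ t, ‖1 - y i‖ < (ℓ : ℝ)⁻¹) : ‖1 - ∏ i ∈ t, y i ^ z i‖ < (ℓ : ℝ)⁻¹ := by
  have hsum : ‖∑ i ∈ t, (z i : E) * plog (y i)‖ < (ℓ : ℝ)⁻¹ :=
    norm_sum_lt_of_forall_lt (ℓ := ℓ) t _ fun i hi => by
      rw [norm_mul, norm_plog_of_norm_lt (ℓ := ℓ) (hy i hi)]
      exact (mul_le_of_le_one_left (norm_nonneg _) (norm_intCast_le_one (ℓ := ℓ) (z i))).trans_lt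
        (hy i hi)
  rw [← exp_sum_intCast_mul_plog (ℓ := ℓ) t y z hy, norm_sub_rev, norm_exp_sub_one (ℓ := ℓ) hsum]
  exact hsum

end Complete

end PadicExp

end Literature.NumberTheory.Transcendental

end
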